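import Literature.NumberTheory.Weil1964.ArchFollandTorusKType
import Literature.NumberTheory.Automorphic.AdelicSchwartzBruhatDirectSumPure
import HarnessLib

/-!
# The Folland–Fock Gaussian of a scaled frame FACTORISES along an index split `ι₁ ⊕ ι₂` (S2d, archimedean part)

Topic `NumberTheory/Weil1964`; namespace `Literature.NumberTheory.Weil1964`.  THEOREMS ONLY.  Cell `hodgecm-mathlib`,
(T2) [Liu2021, Thm 4.15] stub S2 «theta restricts to theta», piece **S2d, archimedean part** (the adelic bookkeeping is the
sibling `Automorphic/AdelicSchwartzBruhatDirectSumSpan`): for a totally real `F` and scale functions `D₁` on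
`ι₁ × {real places}`, `D₂` on `ι₂ × {real places}` (all entries `≠ 0`; in the application `√|x_v(j)|` of the Gram data of an
orthogonal decomposition `V = V⋆ ⊕ V⋆^⊥`, cf. `frameV`), the Gaussian vacuum `h₀ ∘ e_D` of the scaled Folland frame
(`follandHermite (scaledFrame F ι D hD) 0`, [Folland1989] §1.7, (4.39)) on the SUM index `ι₁ ⊕ ι₂` with the juxtaposed scales IS
the product of the two Gaussians in separate variables:
`G_{D₁} ⊠_∞ G_{D₂} = G_{D₁ ⊔ D₂}` (`archBoxTensor`, `archBoxTensor_follandHermite_zero_eq`; the juxtaposed scale has no zero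
entry — hypothesis `hD`, immediate from `hD₁`, `hD₂` by `Sum.rec`).  This is the case `β = 0` of
«Hermite functions in separate variables multiply», generalising the tree's doubled-space instance
`schwartzReindexCLM_archBoxTensor_gaussianV` (two equal copies, reindexed by `Fin n ⊕ Fin n ≃ Fin (n+n)`) to an arbitrary split;
with the sibling file it gives: the adelic test vector `G_{D₁ ⊔ D₂} ⊗ f` is a FINITE SUM OF PURE TENSORS `Φ⋆ ⊠ Φ^⊥` for every
finite component `f` ([Liu2021] proof of Thm 4.15, l. 2199–2203, «in which we use the Fock model at archimedean places»).
[cite: Folland1989, §1.7 and §4.2 Prop. (4.39) (the Gaussian vacuum `h₀` of the Fock model; `h₀(y ⊕ y′) = h₀(y) h₀(y′)`)]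
[cite: Liu2021, proof of Thm. 4.15 (FJcycle.tex l. 2193–2203)]
-/

set_option autoImplicit false

noncomputable section

open NumberField NumberField.InfinitePlace NumberField.mixedEmbedding
open Literature.Analysis.SegalBargmann Literature.NumberTheory.Automorphic
open scoped SchwartzMap Classical

namespace Literature.NumberTheory.Weil1964

variable {F : Type} [Field F] [NumberField F] [IsTotallyReal F] {ι₁ ι₂ : Type} [Fintype ι₁] [Fintype ι₂]

omit [IsTotallyReal F] in
/-- The vacuum coefficients multiply: `2^{|σ₁ ⊕ σ₂|/4} = 2^{|σ₁|/4} · 2^{|σ₂|/4}` for the index sets of the two frames and of the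
juxtaposed frame. [cite: Folland1989, §1.7] -/
private theorem vacCoef_sum_prod :
    ((vacCoef (ι₁ × {v : InfinitePlace F // v.IsReal}) : ℝ) : ℂ) * ((vacCoef (ι₂ × {v : InfinitePlace F // v.IsReal}) : ℝ) : ℂ) =
      ((vacCoef ((ι₁ ⊕ ι₂) × {v : InfinitePlace F // v.IsReal}) : ℝ) : ℂ) := by
  rw [← Complex.ofReal_mul, vacCoef, vacCoef, vacCoef, ← Real.rpow_add (by norm_num : (0 : ℝ) < 2)]
  congr 2
  simp only [Fintype.card_prod, Fintype.card_sum]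
  push_cast
  ring

/-- **The Gaussian of the juxtaposed scaled frame is the separate-variables product of the two Gaussians**:
`archBoxTensor (h₀ ∘ e_{D₁}) (h₀ ∘ e_{D₂}) = h₀ ∘ e_{D₁ ⊔ D₂}` on `𝓢((F ⊗ ℝ)^{ι₁ ⊕ ι₂})`, `F` totally real — the Fock-model
vacuum vector attached to an ORTHOGONAL decomposition is a PURE TENSOR along it (Liu: «we use the Fock model at archimedean
places», l. 2197; the constants `2^{|σ|/4}` multiply and the quadratic form in the exponent splits as the sum over the two blocks).
[cite: Folland1989, §1.7 and §4.2 Prop. (4.39)] [cite: Liu2021, proof of Thm. 4.15 (FJcycle.tex l. 2193–2203)] -/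
theorem archBoxTensor_follandHermite_zero_eq (D₁ : ι₁ × {v : InfinitePlace F // v.IsReal} → ℝ) (hD₁ : ∀ k, D₁ k ≠ 0)
    (D₂ : ι₂ × {v : InfinitePlace F // v.IsReal} → ℝ) (hD₂ : ∀ k, D₂ k ≠ 0)
    (hD : ∀ k : (ι₁ ⊕ ι₂) × {v : InfinitePlace F // v.IsReal}, Sum.elim (fun i => D₁ (i, k.2)) (fun j => D₂ (j, k.2)) k.1 ≠ 0) :
    archBoxTensor (follandHermite (scaledFrame F ι₁ D₁ hD₁) 0) (follandHermite (scaledFrame F ι₂ D₂ hD₂) 0) =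
      follandHermite (scaledFrame F (ι₁ ⊕ ι₂) (fun k => Sum.elim (fun i => D₁ (i, k.2)) (fun j => D₂ (j, k.2)) k.1) hD) 0 := by
  ext x
  rw [archBoxTensor_apply]
  simp only [follandHermite_apply, hermitePi_apply, herm_zero, hermiteFun, vac, MvPolynomial.eval_C, gauss]
  rw [mul_mul_mul_comm, vacCoef_sum_prod, ← Complex.exp_add]
  congr 2
  rw [← mul_add]
  congr 1
  -- the quadratic form on `(ι₁ ⊕ ι₂) × {real places}` is the sum of the two block forms
  symm
  simp only [Fintype.sum_prod_type, Fintype.sum_sum_type, scaledFrame_apply, Sum.elim_inl, Sum.elim_inr,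
    Function.comp_apply]

/-- **Corollary (with the adelic bookkeeping): the adelic test vector with archimedean component the Gaussian of the juxtaposed
frame is a finite sum of pure tensors `Φ⋆ ⊠ Φ^⊥` along `ι₁ ⊕ ι₂`, for EVERY finite component** — i.e. it lies in the `ℂ`-span
of the range of `tensorToSum F ι₁ ι₂` (Liu, l. 2199–2203 «we can find finitely many pairs …»).
[cite: Liu2021, proof of Thm. 4.15 (FJcycle.tex l. 2199–2203)] [cite: Folland1989, §1.7] -/
theorem piSchwartzBruhatEquiv_follandHermite_zero_tmul_eq_tensorToSum
    (D₁ : ι₁ × {v : InfinitePlace F // v.IsReal} → ℝ) (hD₁ : ∀ k, D₁ k ≠ 0)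
    (D₂ : ι₂ × {v : InfinitePlace F // v.IsReal} → ℝ) (hD₂ : ∀ k, D₂ k ≠ 0)
    (hD : ∀ k : (ι₁ ⊕ ι₂) × {v : InfinitePlace F // v.IsReal}, Sum.elim (fun i => D₁ (i, k.2)) (fun j => D₂ (j, k.2)) k.1 ≠ 0)
    (f₁ : FinSB F ι₁) (f₂ : FinSB F ι₂) :
    piSchwartzBruhatEquiv F (ι₁ ⊕ ι₂)
        (follandHermite (scaledFrame F (ι₁ ⊕ ι₂) (fun k => Sum.elim (fun i => D₁ (i, k.2)) (fun j => D₂ (j, k.2)) k.1) hD) 0 ⊗ₜ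
          finSumEquiv F ι₁ ι₂ (f₁ ⊗ₜ f₂)) =
      tensorToSum F ι₁ ι₂ (piSchwartzBruhatEquiv F ι₁ (follandHermite (scaledFrame F ι₁ D₁ hD₁) 0 ⊗ₜ f₁))
        (piSchwartzBruhatEquiv F ι₂ (follandHermite (scaledFrame F ι₂ D₂ hD₂) 0 ⊗ₜ f₂)) := by
  rw [← archBoxTensor_follandHermite_zero_eq D₁ hD₁ D₂ hD₂ hD]
  exact (tensorToSum_tmul _ _ _ _).symm

end Literature.NumberTheory.Weil1964

end
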